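import Mathlib
import Literature.NumberTheory.LFunctions.Zhang2022.Section14Eq143Core
import Literature.NumberTheory.LFunctions.Zhang2022.Section14Eq143Shift
import Literature.NumberTheory.LFunctions.Zhang2022.Section14Eq143Tail
import Literature.NumberTheory.LFunctions.Zhang2022.Section7Eq73Edge
import Literature.NumberTheory.LFunctions.Zhang2022.Section3Prop21
import HarnessLib

/-!
# Zhang (2022) §14, (14.3): the deduction `DedEq143` DISCHARGED

Topic `Literature/NumberTheory/LFunctions/Zhang2022` (Landau–Siegel adjudication tree; verdict-neutral;
cell siegel-zhang, DAG deduction node `Z22:(14.3)` = `Typed.Sec14.DedEq143`).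
Y. Zhang, *Discrete mean estimates and the Landau–Siegel zero*, arXiv:2211.02515v1 (2022)
[Zhang2022LandauSiegel] — **an unrefereed manuscript under adjudication; nothing here bears on its
Theorems 1–2 or on Landau–Siegel zeros.** §14 p. 76 (tex L3849–L3855):

> "Similar to the proof of Proposition 7.1, by (14.1), (14.2) and Proposition 2.1, we can extend the
> sum over `Ψ₁` to the sum over `Ψ`, with acceptable errors. Namely we have
> `Θ₂ = Σ_{ψ∈Ψ} Ĩ₂(ψ) + o(𝔓)`. (14.3)"

This file PROVES (theorems only; no new definition, no named fact)
`Typed.Sec14.Eq143.dedEq143_holds : Typed.Sec14.DedEq143` (`= Prop21 → Lemma33a → Lemma33b → Eq143`),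
via `dedEq143_of_tail` — the deduction GIVEN the tail step, stated inline as the hypothesis `htail`
(the (14.3) twin of `Z22:§7.u017`, "moving the segment to `𝔍(𝓛⁹)` … `≪ ε`": eventually, for every
`ψ ∈ Ψ`, `‖∫_{𝔍(1)} Z(s,ψχ)⁻¹ (Σ_{m>⌊P²⌋} κ*(m)ψ(m)m^{−s}) A(s) ω(s) ds‖ ≤ C·e^{−𝓛¹⁰/16}`) — fed
with `Typed.Sec14.Eq143.tail` (`Section14Eq143Tail`), which proves exactly that.
The proof is the §7 recipe (`Section7Eq73Edge.dedEq73_holds`, L2-t2/d18) for the §14 objects: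
`Θ₂(0) − Σ_Ψ Ĩ₂ = −Σ_{Ψ₂} Ĩ₂` (`Ψ = Ψ₁ ⊔ Ψ₂`, `Typed.Sec14.theta2_zero_eq`); for each `ψ`,
`Ĩ₂(ψ) = (1/2πi)∫_{𝔍(1)}` of `Z⁻¹·(head + tail)·A·ω` on `σ = 3/2`
(`tsum_twist_eq_head_add_LSeries`); the head is moved to `𝔍(0)` (`shift`), where the sum over `Ψ₂`
is `≤ K𝔓𝓛⁻⁵` pointwise (`core`: Hölder, Lemma 3.3 (ii), Prop. 2.1) and `∫_{𝔍(0)}|ω||ds| ≪ 1`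
((7.4), `Section7aStatements.eq74_holds`); the per-`ψ` errors `O(e^{−𝓛¹⁰/16})` are absorbed by
`#Ψ₂ ≤ 𝔓` (`Section7Eq73Edge.card_finsetOf_PsiTwo_le_frakP`).

## References

* Y. Zhang, arXiv:2211.02515v1 (2022), §14 (14.3) p. 76; §7 (7.3)–(7.5) pp. 34–35.
  [cite: Zhang2022LandauSiegel, §14 (14.3) p. 76]
-/

noncomputable section

open Complex Real Set MeasureTheory intervalIntegral
open scoped ComplexConjugate

namespace Literature.NumberTheory.LFunctions.Zhang2022.Typed.Sec14.Eq143

open Skeleton Section7aStatements Section7Eq73Edge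

/-! ### Bookkeeping: `Ψ = Ψ₁ ⊔ Ψ₂`, `Ĩ₂` versus `∫_{𝔍(1)}` -/

/-- `Σ_{ψ∈Ψ} = Σ_{ψ∈Ψ₁} + Σ_{ψ∈Ψ₂}` ("`Ψ₂` the complement of `Ψ₁` in `Ψ`", Prop. 2.1).
[cite: Zhang2022LandauSiegel, §2 Prop. 2.1 p. 6] -/
theorem sum_finsetOf_univ_eq {D : ℕ} [NeZero D] (χ : DirichletCharacter ℂ D) (f : Chr D → ℂ) :
    ∑ x ∈ finsetOf (Set.univ : Set (Chr D)), f x =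
      ∑ x ∈ finsetOf (PsiOne χ), f x + ∑ x ∈ finsetOf (PsiTwo χ), f x := by
  classical
  have hU : (Set.univ : Set (Chr D)).Finite := Set.toFinite _
  have h1 : (PsiOne χ).Finite := Set.toFinite _
  have h2 : (PsiTwo χ).Finite := Set.toFinite _
  have hdisj : Disjoint (finsetOf (PsiOne χ)) (finsetOf (PsiTwo χ)) := by
    rw [Finset.disjoint_left]
    intro x hx hx2
    rw [mem_finsetOf h1] at hx
    rw [mem_finsetOf h2, PsiTwo, Set.mem_compl_iff] at hx2
    exact hx2 hx
  rw [← Finset.sum_union hdisj]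
  refine Finset.sum_congr ?_ fun _ _ => rfl
  ext x
  rw [Finset.mem_union, mem_finsetOf hU, mem_finsetOf h1, mem_finsetOf h2, PsiTwo, Set.mem_compl_iff]
  simpa using em (x ∈ PsiOne χ)

/-- `|Ĩ₂(ψ)| ≤ ‖∫_{𝔍(1)} F ds‖` (`Ĩ₂ = (1/2πi)∫_{𝔍(1)} F ds`, `2π ≥ 1`; `∫_{𝔍(z)}` = `Section7aStatements.intJ`).
[cite: Zhang2022LandauSiegel, §14 p. 76 (definition of `Ĩ₂`)] -/
theorem norm_segInt_le_norm_intJ (D : ℕ) (z : ℝ) (F : ℂ → ℂ) :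
    ‖Lemma81.segInt (t0 D) (ell1 D) z F‖ ≤ ‖intJ D z F‖ := by
  have h : ‖intJ D z F‖ = 2 * π * ‖Lemma81.segInt (t0 D) (ell1 D) z F‖ := by
    rw [intJ, norm_mul, norm_mul, norm_mul, Complex.norm_I, Complex.norm_real, Complex.norm_ofNat,
      Real.norm_of_nonneg Real.pi_pos.le, mul_one]
  rw [h]
  have h1 : (1 : ℝ) ≤ 2 * π := by linarith [Real.pi_gt_three]
  nlinarith [norm_nonneg (Lemma81.segInt (t0 D) (ell1 D) z F)]

/-- `2πt₀ − 𝓛₁ > 0` for `𝓛 ≥ 1`. [folklore] -/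
private theorem twoPiT0_sub_ell1_pos'' {D : ℕ} (hℓ : 1 ≤ ell D) : 0 < 2 * π * t0 D - ell1 D := by
  have h1 : ell D ^ 405 ≤ ell D ^ 519 := pow_le_pow_right₀ hℓ (by norm_num)
  have h2 : 1 ≤ ell D ^ 519 := one_le_pow₀ hℓ
  rw [t0, ell1]; nlinarith [Real.pi_gt_three]

/-! ### The deduction -/

/-- **`Z22:(14.3)` DEDUCTION, modulo the tail integral**: `DedEq143 = Prop21 → Lemma33a → Lemma33b →
Eq143` holds GIVEN `htail`, the (14.3) twin of `Z22:§7.u017` (the integral over `𝔍(1)` of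
`Z(s,ψχ)⁻¹·(Σ_{m>⌊P²⌋}κ*(m)ψ(m)m^{−s})·A(s)·ω(s)` is `O(e^{−𝓛¹⁰/16})` for every `ψ ∈ Ψ`). Proof:
`Θ₂ − Σ_Ψ Ĩ₂ = −Σ_{Ψ₂} Ĩ₂`; `Ĩ₂(ψ) = (2πi)⁻¹(∫_{𝔍(1)} head-part + ∫_{𝔍(1)} tail-part)`; the head
part is `≤ ∫_{𝔍(0)}|M||Aω||ds| + O(e^{−𝓛¹⁰/16})` (`shift`), and `Σ_{Ψ₂}∫_{𝔍(0)}|M||A||ω||ds| ≤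
K𝔓𝓛⁻⁵·∫_{𝔍(0)}|ω||ds| ≤ K𝔓𝓛⁻⁵C₇₄` (`core`, (7.4)); `#Ψ₂ ≤ 𝔓`; for `𝓛` large the total is `≤ ε𝔓`.
`Lemma33a` is not used (it serves (14.6), not (14.3)). [cite: Zhang2022LandauSiegel, §14 (14.3) p. 76] -/
theorem dedEq143_of_tail
    (htail : ∀ B : ℝ, ∃ C : ℝ, ForAllLarge fun D _ χ => ∀ (x : Chr D) (κs as : ℕ → ℂ),
      Eq141 B κs → (∀ n : ℕ, ‖as n‖ ≤ B) →
        ‖intJ D 1 (fun s => (Zpc χ x s)⁻¹ *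
            LSeries (fun m : ℕ => if ⌊bigP D ^ 2⌋₊ < m then κs m * x.ψ (m : ZMod x.p) else 0) s *
            (∑ n ∈ Finset.Icc 1 ⌊2 * P4 D⌋₊,
              as n * conj (x.ψ (n : ZMod x.p)) * (n : ℂ) ^ (s - 1)) * omegaW D s)‖ ≤
          C * Real.exp (-(1 / 16) * ell D ^ 10)) :
    DedEq143 := by
  intro h21 _ h33b B ε hε
  obtain ⟨K, D₁, Hcore⟩ := core h21 h33b B
  obtain ⟨C₇₄, D₂, H74⟩ := eq74_holds
  obtain ⟨Cs, D₃, Hs⟩ := shift B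
  obtain ⟨Ct, D₄, Ht⟩ := htail B
  set K' : ℝ := max K 0 with hK'
  set C' : ℝ := max C₇₄ 0 with hC'
  set M : ℝ := max 1 (max (2 * K' * C' / ε) (32 * (|Cs| + |Ct|) / ε)) with hMdef
  obtain ⟨D₅, H5⟩ := exists_nat_forall_le_ell M
  refine ⟨max (max (max D₁ D₂) (max D₃ D₄)) (max D₅ 3), fun D _ χ hD hq hp hA κs as hκ has => ?_⟩
  have hD12 : max D₁ D₂ ≤ D := le_trans (le_trans (le_max_left _ _) (le_max_left _ _)) hD
  have hD34 : max D₃ D₄ ≤ D := le_trans (le_trans (le_max_right _ _) (le_max_left _ _)) hD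
  have hD1 : D₁ ≤ D := le_trans (le_max_left _ _) hD12
  have hD2 : D₂ ≤ D := le_trans (le_max_right _ _) hD12
  have hD3 : D₃ ≤ D := le_trans (le_max_left _ _) hD34
  have hD4 : D₄ ≤ D := le_trans (le_max_right _ _) hD34
  have hD5 : D₅ ≤ D := le_trans (le_trans (le_max_left _ _) (le_max_right _ _)) hD
  have hD3' : 3 ≤ D := le_trans (le_trans (le_max_right _ _) (le_max_right _ _)) hD
  have hM := H5 D hD5
  have hℓ1 : 1 ≤ ell D := le_trans (le_max_left _ _) hM
  have hℓ0 : 0 < ell D := by linarith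
  have hL0 : 0 ≤ ell1 D := by rw [ell1]; positivity
  have hside : 0 < 2 * π * t0 D - ell1 D := twoPiT0_sub_ell1_pos'' hℓ1
  -- notation
  set X : ℕ := ⌊bigP D ^ 2⌋₊ with hX
  set S := finsetOf (PsiTwo χ) with hSdef
  set e : ℝ := Real.exp (-(1 / 16) * ell D ^ 10) with hedef
  have he : 0 < e := Real.exp_pos _
  have hfrakP : 0 ≤ frakP D := le_trans (Nat.cast_nonneg _) (card_finsetOf_PsiTwo_le_frakP χ)
  -- the three integrands, per character
  set Mf : Chr D → ℂ → ℂ := fun x s =>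
    ∑ m ∈ Finset.Icc 1 X, κs m * x.ψ (m : ZMod x.p) * (m : ℂ) ^ (-s) with hMf
  set Lf : Chr D → ℂ → ℂ := fun x s =>
    LSeries (fun m : ℕ => if X < m then κs m * x.ψ (m : ZMod x.p) else 0) s with hLf
  set Af : Chr D → ℂ → ℂ := fun x s =>
    ∑ n ∈ Finset.Icc 1 ⌊2 * P4 D⌋₊, as n * conj (x.ψ (n : ZMod x.p)) * (n : ℂ) ^ (s - 1) with hAf
  set Ffull : Chr D → ℂ → ℂ := fun x s =>
    (Zpc χ x s)⁻¹ * (∑' m : ℕ, κs m * x.ψ (m : ZMod x.p) * (m : ℂ) ^ (-s)) * Af x s * omegaW D s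
    with hFfull
  set Ffin : Chr D → ℂ → ℂ := fun x s => (Zpc χ x s)⁻¹ * Mf x s * Af x s * omegaW D s with hFfin
  set Ftail : Chr D → ℂ → ℂ := fun x s => (Zpc χ x s)⁻¹ * Lf x s * Af x s * omegaW D s with hFtail
  -- Step 1: `Θ₂ − Σ_Ψ Ĩ₂ = −Σ_{Ψ₂} Ĩ₂`
  have hdiff : Theta2 χ 0 κs as - ∑ x ∈ finsetOf (Set.univ : Set (Chr D)), i2Tilde χ x κs as =
      -∑ x ∈ S, i2Tilde χ x κs as := by
    rw [theta2_zero_eq, sum_finsetOf_univ_eq χ]; ring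
  have hI2 : ∀ x : Chr D, i2Tilde χ x κs as = Lemma81.segInt (t0 D) (ell1 D) 1 (Ffull x) :=
    fun x => rfl
  -- Step 2: on `𝔍(1)` the series splits, and so does the integral
  have hpt_re : ∀ v : ℝ, (((1 : ℝ) : ℂ) + s0 D + v * I).re = 3 / 2 := by
    intro v; simp [s0, SmoothWeight.s0]; norm_num
  have hpt_im : ∀ v : ℝ, (((1 : ℝ) : ℂ) + s0 D + v * I).im = 2 * π * t0 D + v := by
    intro v; simp [s0, SmoothWeight.s0]
  have hsplit_pt : ∀ (x : Chr D) (v : ℝ),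
      Ffull x (((1 : ℝ) : ℂ) + s0 D + v * I) =
        Ffin x (((1 : ℝ) : ℂ) + s0 D + v * I) + Ftail x (((1 : ℝ) : ℂ) + s0 D + v * I) := by
    intro x v
    have hs : 1 < (((1 : ℝ) : ℂ) + s0 D + v * I).re := by rw [hpt_re]; norm_num
    simp only [hFfull, hFfin, hFtail, hMf, hLf]
    rw [tsum_twist_eq_head_add_LSeries x hκ X hs]; ring
  -- continuity of the integrands along `𝔍(1)` (for `|v| ≤ 𝓛₁`, where `Im s > 0`)
  have hopen : IsOpen {s : ℂ | 1 < s.re} := isOpen_lt continuous_const Complex.continuous_re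
  have hcont : ∀ (x : Chr D) (G : ℂ → ℂ), DifferentiableOn ℂ G {s : ℂ | 1 < s.re} →
      ContinuousOn (fun v : ℝ => (Zpc χ x (((1 : ℝ) : ℂ) + s0 D + v * I))⁻¹ *
        G (((1 : ℝ) : ℂ) + s0 D + v * I) * Af x (((1 : ℝ) : ℂ) + s0 D + v * I) *
        omegaW D (((1 : ℝ) : ℂ) + s0 D + v * I)) (Set.uIcc (-ell1 D) (ell1 D)) := by
    intro x G hG v hv
    rw [Set.uIcc_of_le (by linarith)] at hv
    have him : 0 < (((1 : ℝ) : ℂ) + s0 D + v * I).im := by rw [hpt_im]; linarith [hv.1]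
    have hre : (((1 : ℝ) : ℂ) + s0 D + v * I) ∈ {s : ℂ | 1 < s.re} := by
      rw [Set.mem_setOf_eq, hpt_re]; norm_num
    have hpt : ContinuousAt (fun v : ℝ => ((1 : ℝ) : ℂ) + s0 D + v * I) v :=
      (continuous_segPoint (D := D) 1).continuousAt
    have h1 : ContinuousAt (fun s => (Zpc χ x s)⁻¹) (((1 : ℝ) : ℂ) + s0 D + v * I) :=
      (differentiableAt_Zpc_inv hD3' hp x him).continuousAt
    have h2 : ContinuousAt G (((1 : ℝ) : ℂ) + s0 D + v * I) :=
      (hG.differentiableAt (hopen.mem_nhds hre)).continuousAt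
    have h3 : ContinuousAt (Af x) (((1 : ℝ) : ℂ) + s0 D + v * I) :=
      ((differentiable_apoly x as).continuous).continuousAt
    have h4 : ContinuousAt (omegaW D) (((1 : ℝ) : ℂ) + s0 D + v * I) :=
      ((differentiable_omegaW D).continuous).continuousAt
    have h1' : ContinuousAt (fun v : ℝ => (Zpc χ x (((1 : ℝ) : ℂ) + s0 D + v * I))⁻¹) v :=
      ContinuousAt.comp (f := fun v : ℝ => ((1 : ℝ) : ℂ) + s0 D + v * I) h1 hpt
    have h2' : ContinuousAt (fun v : ℝ => G (((1 : ℝ) : ℂ) + s0 D + v * I)) v :=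
      ContinuousAt.comp (f := fun v : ℝ => ((1 : ℝ) : ℂ) + s0 D + v * I) h2 hpt
    have h3' : ContinuousAt (fun v : ℝ => Af x (((1 : ℝ) : ℂ) + s0 D + v * I)) v :=
      ContinuousAt.comp (f := fun v : ℝ => ((1 : ℝ) : ℂ) + s0 D + v * I) h3 hpt
    have h4' : ContinuousAt (fun v : ℝ => omegaW D (((1 : ℝ) : ℂ) + s0 D + v * I)) v :=
      ContinuousAt.comp (f := fun v : ℝ => ((1 : ℝ) : ℂ) + s0 D + v * I) h4 hpt
    exact (((h1'.mul h2').mul h3').mul h4').continuousWithinAt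
  have hint_fin : ∀ x : Chr D, IntervalIntegrable
      (fun v : ℝ => Ffin x (((1 : ℝ) : ℂ) + s0 D + v * I)) volume (-ell1 D) (ell1 D) := fun x =>
    (hcont x (Mf x) ((differentiable_head x κs).differentiableOn)).intervalIntegrable
  have hint_tail : ∀ x : Chr D, IntervalIntegrable
      (fun v : ℝ => Ftail x (((1 : ℝ) : ℂ) + s0 D + v * I)) volume (-ell1 D) (ell1 D) := fun x =>
    (hcont x (Lf x) (differentiableOn_LSeries_tail x hκ X)).intervalIntegrable
  have hsplit : ∀ x : Chr D, intJ D 1 (Ffull x) = intJ D 1 (Ffin x) + intJ D 1 (Ftail x) := by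
    intro x
    have e1 : (∫ v in (-ell1 D)..ell1 D, Ffull x (((1 : ℝ) : ℂ) + s0 D + v * I)) =
        ∫ v in (-ell1 D)..ell1 D, (Ffin x (((1 : ℝ) : ℂ) + s0 D + v * I) +
          Ftail x (((1 : ℝ) : ℂ) + s0 D + v * I)) :=
      intervalIntegral.integral_congr fun v _ => hsplit_pt x v
    show 2 * π * I * ((1 / (2 * π) : ℂ) * ∫ v in (-ell1 D)..ell1 D,
        Ffull x (((1 : ℝ) : ℂ) + s0 D + v * I)) =
      2 * π * I * ((1 / (2 * π) : ℂ) * ∫ v in (-ell1 D)..ell1 D,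
        Ffin x (((1 : ℝ) : ℂ) + s0 D + v * I)) +
      2 * π * I * ((1 / (2 * π) : ℂ) * ∫ v in (-ell1 D)..ell1 D,
        Ftail x (((1 : ℝ) : ℂ) + s0 D + v * I))
    rw [e1, intervalIntegral.integral_add (hint_fin x) (hint_tail x)]
    ring
  -- Step 3: the per-character bounds
  have hfinx : ∀ x : Chr D, ‖intJ D 1 (Ffin x)‖ ≤
      absIntJ D 0 (fun s => Mf x s * (Af x s * omegaW D s)) + Cs * e :=
    fun x => Hs D χ hD3 hq hp x κs as hκ has.1
  have htailx : ∀ x : Chr D, ‖intJ D 1 (Ftail x)‖ ≤ Ct * e :=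
    fun x => Ht D χ hD4 hq hp x κs as hκ has.1
  have hperx : ∀ x : Chr D, ‖i2Tilde χ x κs as‖ ≤
      absIntJ D 0 (fun s => Mf x s * (Af x s * omegaW D s)) + (Cs + Ct) * e := by
    intro x
    calc ‖i2Tilde χ x κs as‖ ≤ ‖intJ D 1 (Ffull x)‖ := by
          rw [hI2]; exact norm_segInt_le_norm_intJ D 1 (Ffull x)
      _ = ‖intJ D 1 (Ffin x) + intJ D 1 (Ftail x)‖ := by rw [hsplit]
      _ ≤ ‖intJ D 1 (Ffin x)‖ + ‖intJ D 1 (Ftail x)‖ := norm_add_le _ _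
      _ ≤ absIntJ D 0 (fun s => Mf x s * (Af x s * omegaW D s)) + Cs * e + Ct * e :=
          add_le_add (hfinx x) (htailx x)
      _ = _ := by ring
  -- Step 4: the sum over `Ψ₂` of the `𝔍(0)`-integrals
  have hω : Continuous fun v : ℝ => ‖omegaW D (((0 : ℝ) : ℂ) + s0 D + v * I)‖ :=
    (continuous_omegaW_seg (D := D) 0).norm
  have hG : ∀ x : Chr D, Continuous fun v : ℝ =>
      ‖Mf x (((0 : ℝ) : ℂ) + s0 D + v * I) *
        (Af x (((0 : ℝ) : ℂ) + s0 D + v * I) * omegaW D (((0 : ℝ) : ℂ) + s0 D + v * I))‖ := by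
    intro x
    have hpt := continuous_segPoint (D := D) 0
    exact (((differentiable_head x κs).continuous.comp hpt).mul
      (((differentiable_apoly x as).continuous.comp hpt).mul (continuous_omegaW_seg (D := D) 0))).norm
  have hℓℓ : -ell1 D ≤ ell1 D := by linarith
  have hmain : ∑ x ∈ S, absIntJ D 0 (fun s => Mf x s * (Af x s * omegaW D s)) ≤
      K' * frakP D * (ell D ^ 5)⁻¹ * C' := by
    have hswap : ∑ x ∈ S, absIntJ D 0 (fun s => Mf x s * (Af x s * omegaW D s)) =
        ∫ v in (-ell1 D)..ell1 D, ∑ x ∈ S,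
          ‖Mf x (((0 : ℝ) : ℂ) + s0 D + v * I) *
            (Af x (((0 : ℝ) : ℂ) + s0 D + v * I) * omegaW D (((0 : ℝ) : ℂ) + s0 D + v * I))‖ := by
      rw [intervalIntegral.integral_finsetSum fun x _ => (hG x).intervalIntegrable _ _]
      rfl
    rw [hswap]
    have hpt : ∀ v : ℝ, ∑ x ∈ S,
        ‖Mf x (((0 : ℝ) : ℂ) + s0 D + v * I) *
          (Af x (((0 : ℝ) : ℂ) + s0 D + v * I) * omegaW D (((0 : ℝ) : ℂ) + s0 D + v * I))‖ ≤
        K' * frakP D * (ell D ^ 5)⁻¹ * ‖omegaW D (((0 : ℝ) : ℂ) + s0 D + v * I)‖ := by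
      intro v
      have h := Hcore D χ hD1 hq hp hA κs as hκ has _ (segPoint_zero_re (D := D) v)
      have e1 : ∑ x ∈ S,
          ‖Mf x (((0 : ℝ) : ℂ) + s0 D + v * I) *
            (Af x (((0 : ℝ) : ℂ) + s0 D + v * I) * omegaW D (((0 : ℝ) : ℂ) + s0 D + v * I))‖ =
          (∑ x ∈ S, ‖Mf x (((0 : ℝ) : ℂ) + s0 D + v * I)‖ *
            ‖Af x (((0 : ℝ) : ℂ) + s0 D + v * I)‖) * ‖omegaW D (((0 : ℝ) : ℂ) + s0 D + v * I)‖ := by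
        rw [Finset.sum_mul]
        exact Finset.sum_congr rfl fun x _ => by rw [norm_mul, norm_mul, mul_assoc]
      rw [e1]
      refine mul_le_mul_of_nonneg_right (h.trans ?_) (norm_nonneg _)
      have : K * frakP D * (ell D ^ 5)⁻¹ ≤ K' * frakP D * (ell D ^ 5)⁻¹ := by
        have hK : K ≤ K' := le_max_left _ _
        have h5 : 0 ≤ (ell D ^ 5)⁻¹ := by positivity
        nlinarith [mul_nonneg hfrakP h5]
      exact this
    calc ∫ v in (-ell1 D)..ell1 D, ∑ x ∈ S,
          ‖Mf x (((0 : ℝ) : ℂ) + s0 D + v * I) *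
            (Af x (((0 : ℝ) : ℂ) + s0 D + v * I) * omegaW D (((0 : ℝ) : ℂ) + s0 D + v * I))‖
        ≤ ∫ v in (-ell1 D)..ell1 D,
            K' * frakP D * (ell D ^ 5)⁻¹ * ‖omegaW D (((0 : ℝ) : ℂ) + s0 D + v * I)‖ :=
          intervalIntegral.integral_mono_on hℓℓ
            ((continuous_finsetSum _ fun x _ => hG x).intervalIntegrable _ _)
            ((continuous_const.mul hω).intervalIntegrable _ _) (fun v _ => hpt v)
      _ = K' * frakP D * (ell D ^ 5)⁻¹ * absIntJ D 0 (omegaW D) := by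
          rw [intervalIntegral.integral_const_mul]; rfl
      _ ≤ K' * frakP D * (ell D ^ 5)⁻¹ * C' :=
          mul_le_mul_of_nonneg_left ((H74 D χ hD2 hq hp 0 (by
            rw [abs_zero]; positivity)).trans (le_max_left _ _))
            (mul_nonneg (mul_nonneg (le_max_right _ _) hfrakP) (by positivity))
  -- Step 5: the accumulated per-character errors, `#Ψ₂ ≤ 𝔓`
  have hcount : (S.card : ℝ) * ((Cs + Ct) * e) ≤ frakP D * ((|Cs| + |Ct|) * e) :=
    calc (S.card : ℝ) * ((Cs + Ct) * e) ≤ (S.card : ℝ) * ((|Cs| + |Ct|) * e) :=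
          mul_le_mul_of_nonneg_left (mul_le_mul_of_nonneg_right
            (add_le_add (le_abs_self _) (le_abs_self _)) he.le) (Nat.cast_nonneg _)
      _ ≤ frakP D * ((|Cs| + |Ct|) * e) :=
          mul_le_mul_of_nonneg_right (card_finsetOf_PsiTwo_le_frakP χ) (by positivity)
  -- Step 6: smallness for `𝓛 ≥ M`
  have hsmall1 : K' * (ell D ^ 5)⁻¹ * C' ≤ ε / 2 := by
    have hKC : 0 ≤ K' * C' := mul_nonneg (le_max_right _ _) (le_max_right _ _)
    have h1 : 2 * K' * C' / ε ≤ ell D := le_trans (le_trans (le_max_left _ _) (le_max_right _ _)) hM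
    have h2 : 2 * K' * C' ≤ ε * ell D := by rw [div_le_iff₀ hε] at h1; linarith
    have h5 : ell D ≤ ell D ^ 5 := le_self_pow₀ hℓ1 (by norm_num)
    have h5' : 0 < ell D ^ 5 := by positivity
    rw [show K' * (ell D ^ 5)⁻¹ * C' = K' * C' / ell D ^ 5 by ring, div_le_iff₀ h5']
    nlinarith
  have hsmall2 : (|Cs| + |Ct|) * e ≤ ε / 2 := by
    have hA0 : 0 ≤ |Cs| + |Ct| := by positivity
    have h1 : 32 * (|Cs| + |Ct|) / ε ≤ ell D :=
      le_trans (le_trans (le_max_right _ _) (le_max_right _ _)) hM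
    have h2 : 32 * (|Cs| + |Ct|) ≤ ε * ell D := by rw [div_le_iff₀ hε] at h1; linarith
    -- `e = exp(−𝓛¹⁰/16) ≤ exp(−𝓛/16) ≤ 16/𝓛`
    have h10 : ell D ≤ ell D ^ 10 := le_self_pow₀ hℓ1 (by norm_num)
    have he1 : e ≤ Real.exp (-(ell D / 16)) := Real.exp_le_exp.mpr (by nlinarith)
    have he2 : Real.exp (-(ell D / 16)) ≤ 16 / ell D := by
      have h := Real.add_one_le_exp (ell D / 16)
      rw [Real.exp_neg, inv_eq_one_div, div_le_div_iff₀ (Real.exp_pos _) hℓ0]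
      nlinarith
    have he3 : e ≤ 16 / ell D := he1.trans he2
    calc (|Cs| + |Ct|) * e ≤ (|Cs| + |Ct|) * (16 / ell D) := mul_le_mul_of_nonneg_left he3 hA0
      _ = 16 * (|Cs| + |Ct|) / ell D := by ring
      _ ≤ ε / 2 := by rw [div_le_iff₀ hℓ0]; nlinarith
  -- assemble
  rw [hdiff, norm_neg]
  calc ‖∑ x ∈ S, i2Tilde χ x κs as‖ ≤ ∑ x ∈ S, ‖i2Tilde χ x κs as‖ := norm_sum_le _ _
    _ ≤ ∑ x ∈ S, (absIntJ D 0 (fun s => Mf x s * (Af x s * omegaW D s)) + (Cs + Ct) * e) :=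
        Finset.sum_le_sum fun x _ => hperx x
    _ = ∑ x ∈ S, absIntJ D 0 (fun s => Mf x s * (Af x s * omegaW D s)) +
          (S.card : ℝ) * ((Cs + Ct) * e) := by
        rw [Finset.sum_add_distrib, Finset.sum_const, nsmul_eq_mul]
    _ ≤ K' * frakP D * (ell D ^ 5)⁻¹ * C' + frakP D * ((|Cs| + |Ct|) * e) := add_le_add hmain hcount
    _ = frakP D * (K' * (ell D ^ 5)⁻¹ * C') + frakP D * ((|Cs| + |Ct|) * e) := by ring
    _ ≤ frakP D * (ε / 2) + frakP D * (ε / 2) :=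
        add_le_add (mul_le_mul_of_nonneg_left hsmall1 hfrakP) (mul_le_mul_of_nonneg_left hsmall2 hfrakP)
    _ = ε * frakP D := by ring

/-- **`Z22:(14.3)` DEDUCTION DISCHARGED**: `Typed.Sec14.DedEq143` — "(14.3) ⇐ similar to the proof
of Proposition 7.1, by (14.1), (14.2) and Proposition 2.1" — HOLDS as typed
(`Prop21 → Lemma33a → Lemma33b → Eq143`): `dedEq143_of_tail` fed with the tail step `tail`. With the
tree's `Skeleton.prop21_holds`, `Skeleton.lemma33a_holds`, `Skeleton.lemma33b_holds` this makes (14.3)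
itself (`Typed.Sec14.Eq143`) a theorem under (A). Kernel-checked; 0 new facts.
[cite: Zhang2022LandauSiegel, §14 (14.3) p. 76] -/
theorem dedEq143_holds : DedEq143 := dedEq143_of_tail tail

/-- **(14.3) HOLDS** (`Typed.Sec14.Eq143`: `Θ₂ = Σ_{ψ∈Ψ} Ĩ₂(ψ) + o(𝔓)` under (A), for `κ*`, `a*`
subject to (14.1)–(14.2)) — `dedEq143_holds` applied to the discharged antecedents
`Skeleton.prop21_holds`, `Skeleton.lemma33a_holds`, `Skeleton.lemma33b_holds`.
[cite: Zhang2022LandauSiegel, §14 (14.3) p. 76] -/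
theorem eq143_holds : Eq143 := dedEq143_holds prop21_holds lemma33a_holds lemma33b_holds

end Literature.NumberTheory.LFunctions.Zhang2022.Typed.Sec14.Eq143

end
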